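import Summits.AnomalousDissipation.AnomalousDissipation.Theorems.SolenoidalFractalHomogenisationRealisedQuasiStaticCellLawComovingPairTransport
import Summits.AnomalousDissipation.AnomalousDissipation.Theorems.SolenoidalFractalHomogenisationRealisedQuasiStaticCellLawComovingFrameBridge
import Summits.AnomalousDissipation.AnomalousDissipation.Theorems.SolenoidalFractalHomogenisationRealisedQuasiStaticCellLawPrincipalCosetEnergy
import HarnessLib

/-!
# K2R `RealisedQuasiStaticCellLaw`, line `floquet-bloch`, stub `stub_lowSectorWeakNear`: the START and END hypotheses of
# `isoSector_decay_ae` from the co-moving start / end (helper; `--supports stmt-AnomalousDissipation-20446`)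

Summits-side helper file (everything proved; no definitions, no named facts). Companions of `comoving_hjunc_frames`: with the
reference frame `(ζ₀, k̂ × ζ₀)` of `ℓ^⊥` and `‖u‖² = |⟨ζ₀,u⟩|² + |⟨k̂×ζ₀,u⟩|²` for transversal `u` (`norm_sq_eq_blocks_of_transversal`),
`comoving_start` (p584793) gives `hstart` and `comoving_end` (given the END expansion bound `hEND` of the full transport
`C_{k₀}`) gives `hend` of `isoSector_decay_ae` (p582517), for weights that ARE the co-moving weights.
-/

set_option linter.dupNamespace false

noncomputable section

namespace Summit.AnomalousDissipation.AnomalousDissipation.Theorems.SolenoidalFractalHomogenisation.RealisedQuasiStaticCellLaw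

open Set MeasureTheory Filter Topology Function Complex Matrix
open scoped ComplexConjugate Matrix
open Literature.Analysis Literature.Analysis.FunctionSpaces Literature.Analysis.FunctionSpaces.Torus
open Literature.Analysis.FluidPDE Literature.Analysis.FluidPDE.LatticeShear

variable {k₀ : ℕ}

/-- **The START hypothesis of `isoSector_decay_ae` for the co-moving weights.** -/
theorem comoving_hstart_frames (W : LatticeWord k₀) (ℓ : Fin 3 → ℤ) (hℓ : ℓ ≠ 0)
    (ζr : Fin k₀ → Fin 3 → ℝ) (hζ1 : ∀ j, ζr j ⬝ᵥ ζr j = 1) (hζ0 : ∀ j, ζr j ⬝ᵥ (fun i => ((ℓ i : ℤ) : ℝ)) = 0)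
    (pf : Fin k₀ → ℤ → Fin 3 → ℝ) (hp0 : ∀ j, pf j 0 = ((Real.sqrt ((fun i => ((ℓ i : ℤ) : ℝ)) ⬝ᵥ (fun i => ((ℓ i : ℤ) : ℝ))))⁻¹ • (fun i => ((ℓ i : ℤ) : ℝ))) ⨯₃ ζr j)
    (Λ d0 σo σi g₁ rc rs : Fin k₀ → ℝ) (lam : ℝ) (c₁₁ c₁₂ c₂₁ c₂₂ : ℕ → ℝ)
    (hrc : ∀ j, rc j = ζr ⟨0, W.pos⟩ ⬝ᵥ ζr j) (hrs : ∀ j, rs j = (((Real.sqrt ((fun i => ((ℓ i : ℤ) : ℝ)) ⬝ᵥ (fun i => ((ℓ i : ℤ) : ℝ))))⁻¹ • (fun i => ((ℓ i : ℤ) : ℝ))) ⨯₃ ζr ⟨0, W.pos⟩) ⬝ᵥ ζr j)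
    (hC0 : c₁₁ 0 = 1 ∧ c₁₂ 0 = 0 ∧ c₂₁ 0 = 0 ∧ c₂₂ 0 = 1)
    (wa wb : ℕ → Fin k₀ → ℝ → ℝ) (wc : ℕ → Fin k₀ → ℝ → ℂ)
    (hwa : ∀ q : ℕ, ∀ j : Fin k₀, ∀ t : ℝ, wa q j t = Real.exp (-(2 * lam * (t - (q : ℝ) * W.period)) + 2 * (Λ j * (d0 j * (t - ((q : ℝ) * W.period + W.start j)) + σo j * g₁ j ^ 2 * (∫ s in (0:ℝ)..(t - ((q : ℝ) * W.period + W.start j)), LatticeWord.trapezoid 0 (W.phase j).τ W.ramp s ^ 2)))) * ((c₁₁ j * rc j + c₁₂ j * rs j) ^ 2 + (c₂₁ j * rc j + c₂₂ j * rs j) ^ 2))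
    (hwb : ∀ q : ℕ, ∀ j : Fin k₀, ∀ t : ℝ, wb q j t = Real.exp (-(2 * lam * (t - (q : ℝ) * W.period)) + 2 * (Λ j * (d0 j * (t - ((q : ℝ) * W.period + W.start j)) + σi j * g₁ j ^ 2 * (∫ s in (0:ℝ)..(t - ((q : ℝ) * W.period + W.start j)), LatticeWord.trapezoid 0 (W.phase j).τ W.ramp s ^ 2)))) * ((-(c₁₁ j * rs j) + c₁₂ j * rc j) ^ 2 + (-(c₂₁ j * rs j) + c₂₂ j * rc j) ^ 2))
    (hwc : ∀ q : ℕ, ∀ j : Fin k₀, ∀ t : ℝ, wc q j t = (((Real.exp (-(2 * lam * (t - (q : ℝ) * W.period)) + (Λ j * (d0 j * (t - ((q : ℝ) * W.period + W.start j)) + σo j * g₁ j ^ 2 * (∫ s in (0:ℝ)..(t - ((q : ℝ) * W.period + W.start j)), LatticeWord.trapezoid 0 (W.phase j).τ W.ramp s ^ 2))) + (Λ j * (d0 j * (t - ((q : ℝ) * W.period + W.start j)) + σi j * g₁ j ^ 2 * (∫ s in (0:ℝ)..(t - ((q : ℝ) * W.period + W.start j)), LatticeWord.trapezoid 0 (W.phase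 j).τ W.ramp s ^ 2)))) * ((c₁₁ j * rc j + c₁₂ j * rs j) * (-(c₁₁ j * rs j) + c₁₂ j * rc j) + (c₂₁ j * rc j + c₂₂ j * rs j) * (-(c₂₁ j * rs j) + c₂₂ j * rc j))) : ℝ) : ℂ)) :
    ∀ q : ℕ, ∀ u : EuclideanSpace ℂ (Fin 3), (fun i => ((ℓ i : ℤ) : ℂ)) ⬝ᵥ WithLp.ofLp u = 0 →
        wa q ⟨0, W.pos⟩ ((q : ℝ) * W.period + W.start ⟨0, W.pos⟩) * ‖inner ℂ (WithLp.toLp 2 (Complex.ofReal ∘ ζr ⟨0, W.pos⟩) : EuclideanSpace ℂ (Fin 3)) u‖ ^ 2 +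
          wb q ⟨0, W.pos⟩ ((q : ℝ) * W.period + W.start ⟨0, W.pos⟩) * ‖inner ℂ (WithLp.toLp 2 (Complex.ofReal ∘ pf ⟨0, W.pos⟩ 0) : EuclideanSpace ℂ (Fin 3)) u‖ ^ 2 +
          2 * (wc q ⟨0, W.pos⟩ ((q : ℝ) * W.period + W.start ⟨0, W.pos⟩) * conj (inner ℂ (WithLp.toLp 2 (Complex.ofReal ∘ ζr ⟨0, W.pos⟩) : EuclideanSpace ℂ (Fin 3)) u) * inner ℂ (WithLp.toLp 2 (Complex.ofReal ∘ pf ⟨0, W.pos⟩ 0) : EuclideanSpace ℂ (Fin 3)) u).re ≤ ‖u‖ ^ 2 := by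
  intro q u hu
  have h00 := hζ1 ⟨0, W.pos⟩
  have h0k := hζ0 ⟨0, W.pos⟩
  have hrot : ∀ j, rc j ^ 2 + rs j ^ 2 = 1 := fun j => by
    rw [hrc j, hrs j]; exact (frame_bridge_inner hℓ h00 h0k (hζ1 j) (hζ0 j) u).2.2
  have hx : ((Real.sqrt ((fun i => ((ℓ i : ℤ) : ℝ)) ⬝ᵥ (fun i => ((ℓ i : ℤ) : ℝ))))⁻¹ • (fun i => ((ℓ i : ℤ) : ℝ))) ⨯₃ ζr ⟨0, W.pos⟩ = (Real.sqrt ((fun i => ((ℓ i : ℤ) : ℝ)) ⬝ᵥ (fun i => ((ℓ i : ℤ) : ℝ))))⁻¹ • ((fun i => ((ℓ i : ℤ) : ℝ)) ⨯₃ ζr ⟨0, W.pos⟩) := by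
    rw [LinearMap.map_smul, LinearMap.smul_apply]
  obtain ⟨ea, eb, -⟩ := frame_bridge_inner hℓ h00 h0k (hζ1 ⟨0, W.pos⟩) (hζ0 ⟨0, W.pos⟩) u
  rw [← hrc ⟨0, W.pos⟩, ← hrs ⟨0, W.pos⟩] at ea eb
  have h := comoving_start W Λ d0 σo σi g₁ rc rs lam c₁₁ c₁₂ c₂₁ c₂₂ hrot hC0 q
    (inner ℂ (WithLp.toLp 2 (Complex.ofReal ∘ ζr ⟨0, W.pos⟩) : EuclideanSpace ℂ (Fin 3)) u)
    (inner ℂ (WithLp.toLp 2 (Complex.ofReal ∘ (((Real.sqrt ((fun i => ((ℓ i : ℤ) : ℝ)) ⬝ᵥ (fun i => ((ℓ i : ℤ) : ℝ))))⁻¹ • (fun i => ((ℓ i : ℤ) : ℝ))) ⨯₃ ζr ⟨0, W.pos⟩)) : EuclideanSpace ℂ (Fin 3)) u)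
  rw [← ea, ← eb, ← hp0 ⟨0, W.pos⟩] at h
  rw [norm_sq_eq_blocks_of_transversal hℓ h00 h0k u hu, ← hx, ← hp0 ⟨0, W.pos⟩]
  simp only [hwa, hwb, hwc]
  exact h

/-- **The END hypothesis of `isoSector_decay_ae` for the co-moving weights**, given the END expansion bound of `C_{k₀}`. -/
theorem comoving_hend_frames (W : LatticeWord k₀) (ℓ : Fin 3 → ℤ) (hℓ : ℓ ≠ 0)
    (ζr : Fin k₀ → Fin 3 → ℝ) (hζ1 : ∀ j, ζr j ⬝ᵥ ζr j = 1) (hζ0 : ∀ j, ζr j ⬝ᵥ (fun i => ((ℓ i : ℤ) : ℝ)) = 0)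
    (pf : Fin k₀ → ℤ → Fin 3 → ℝ) (hp0 : ∀ j, pf j 0 = ((Real.sqrt ((fun i => ((ℓ i : ℤ) : ℝ)) ⬝ᵥ (fun i => ((ℓ i : ℤ) : ℝ))))⁻¹ • (fun i => ((ℓ i : ℤ) : ℝ))) ⨯₃ ζr j)
    (Λ d0 σo σi g₁ rc rs : Fin k₀ → ℝ) (lam : ℝ) (c₁₁ c₁₂ c₂₁ c₂₂ : ℕ → ℝ)
    (hrc : ∀ j, rc j = ζr ⟨0, W.pos⟩ ⬝ᵥ ζr j) (hrs : ∀ j, rs j = (((Real.sqrt ((fun i => ((ℓ i : ℤ) : ℝ)) ⬝ᵥ (fun i => ((ℓ i : ℤ) : ℝ))))⁻¹ • (fun i => ((ℓ i : ℤ) : ℝ))) ⨯₃ ζr ⟨0, W.pos⟩) ⬝ᵥ ζr j)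
    (hCsucc : ∀ j : Fin k₀, c₁₁ ((j : ℕ) + 1) = c₁₁ j * (rc j ^ 2 * Real.exp (Λ j * (d0 j * (W.phase j).τ + σo j * g₁ j ^ 2 * ((W.phase j).τ * (1 - 4 * W.ramp / 3)))) + rs j ^ 2 * Real.exp (Λ j * (d0 j * (W.phase j).τ + σi j * g₁ j ^ 2 * ((W.phase j).τ * (1 - 4 * W.ramp / 3))))) + c₁₂ j * (rc j * rs j * (Real.exp (Λ j * (d0 j * (W.phase j).τ + σo j * g₁ j ^ 2 * ((W.phase j).τ * (1 - 4 * W.ramp / 3)))) - Real.exp (Λ j * (d0 j * (W.phase j).τ + σi j * g₁ j ^ 2 * ((W.phase j).τ * (1 - 4 * W.ramp / 3)))))) ∧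
        c₁₂ ((j : ℕ) + 1) = c₁₁ j * (rc j * rs j * (Real.exp (Λ j * (d0 j * (W.phase j).τ + σo j * g₁ j ^ 2 * ((W.phase j).τ * (1 - 4 * W.ramp / 3)))) - Real.exp (Λ j * (d0 j * (W.phase j).τ + σi j * g₁ j ^ 2 * ((W.phase j).τ * (1 - 4 * W.ramp / 3)))))) + c₁₂ j * (rs j ^ 2 * Real.exp (Λ j * (d0 j * (W.phase j).τ + σo j * g₁ j ^ 2 * ((W.phase j).τ * (1 - 4 * W.ramp / 3)))) + rc j ^ 2 * Real.exp (Λ j * (d0 j * (W.phase j).τ + σi j * g₁ j ^ 2 * ((W.phase j).τ * (1 - 4 * W.ramp / 3))))) ∧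
        c₂₁ ((j : ℕ) + 1) = c₂₁ j * (rc j ^ 2 * Real.exp (Λ j * (d0 j * (W.phase j).τ + σo j * g₁ j ^ 2 * ((W.phase j).τ * (1 - 4 * W.ramp / 3)))) + rs j ^ 2 * Real.exp (Λ j * (d0 j * (W.phase j).τ + σi j * g₁ j ^ 2 * ((W.phase j).τ * (1 - 4 * W.ramp / 3))))) + c₂₂ j * (rc j * rs j * (Real.exp (Λ j * (d0 j * (W.phase j).τ + σo j * g₁ j ^ 2 * ((W.phase j).τ * (1 - 4 * W.ramp / 3)))) - Real.exp (Λ j * (d0 j * (W.phase j).τ + σi j * g₁ j ^ 2 * ((W.phase j).τ * (1 - 4 * W.ramp / 3)))))) ∧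
        c₂₂ ((j : ℕ) + 1) = c₂₁ j * (rc j * rs j * (Real.exp (Λ j * (d0 j * (W.phase j).τ + σo j * g₁ j ^ 2 * ((W.phase j).τ * (1 - 4 * W.ramp / 3)))) - Real.exp (Λ j * (d0 j * (W.phase j).τ + σi j * g₁ j ^ 2 * ((W.phase j).τ * (1 - 4 * W.ramp / 3)))))) + c₂₂ j * (rs j ^ 2 * Real.exp (Λ j * (d0 j * (W.phase j).τ + σo j * g₁ j ^ 2 * ((W.phase j).τ * (1 - 4 * W.ramp / 3)))) + rc j ^ 2 * Real.exp (Λ j * (d0 j * (W.phase j).τ + σi j * g₁ j ^ 2 * ((W.phase j).τ * (1 - 4 * W.ramp / 3))))))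
    (hEND : ∀ z₁ z₂ : ℝ, Real.exp (2 * lam * W.period) * (z₁ ^ 2 + z₂ ^ 2) ≤
      (c₁₁ k₀ * z₁ + c₁₂ k₀ * z₂) ^ 2 + (c₂₁ k₀ * z₁ + c₂₂ k₀ * z₂) ^ 2)
    (wa wb : ℕ → Fin k₀ → ℝ → ℝ) (wc : ℕ → Fin k₀ → ℝ → ℂ)
    (hwa : ∀ q : ℕ, ∀ j : Fin k₀, ∀ t : ℝ, wa q j t = Real.exp (-(2 * lam * (t - (q : ℝ) * W.period)) + 2 * (Λ j * (d0 j * (t - ((q : ℝ) * W.period + W.start j)) + σo j * g₁ j ^ 2 * (∫ s in (0:ℝ)..(t - ((q : ℝ) * W.period + W.start j)), LatticeWord.trapezoid 0 (W.phase j).τ W.ramp s ^ 2)))) * ((c₁₁ j * rc j + c₁₂ j * rs j) ^ 2 + (c₂₁ j * rc j + c₂₂ j * rs j) ^ 2))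
    (hwb : ∀ q : ℕ, ∀ j : Fin k₀, ∀ t : ℝ, wb q j t = Real.exp (-(2 * lam * (t - (q : ℝ) * W.period)) + 2 * (Λ j * (d0 j * (t - ((q : ℝ) * W.period + W.start j)) + σi j * g₁ j ^ 2 * (∫ s in (0:ℝ)..(t - ((q : ℝ) * W.period + W.start j)), LatticeWord.trapezoid 0 (W.phase j).τ W.ramp s ^ 2)))) * ((-(c₁₁ j * rs j) + c₁₂ j * rc j) ^ 2 + (-(c₂₁ j * rs j) + c₂₂ j * rc j) ^ 2))
    (hwc : ∀ q : ℕ, ∀ j : Fin k₀, ∀ t : ℝ, wc q j t = (((Real.exp (-(2 * lam * (t - (q : ℝ) * W.period)) + (Λ j * (d0 j * (t - ((q : ℝ) * W.period + W.start j)) + σo j * g₁ j ^ 2 * (∫ s in (0:ℝ)..(t - ((q : ℝ) * W.period + W.start j)), LatticeWord.trapezoid 0 (W.phase j).τ W.ramp s ^ 2))) + (Λ j * (d0 j * (t - ((q : ℝ) * W.period + W.start j)) + σi j * g₁ j ^ 2 * (∫ s in (0:ℝ)..(t - ((q : ℝ) * W.period + W.start j)), LatticeWord.trapezoid 0 (W.phase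 j).τ W.ramp s ^ 2)))) * ((c₁₁ j * rc j + c₁₂ j * rs j) * (-(c₁₁ j * rs j) + c₁₂ j * rc j) + (c₂₁ j * rc j + c₂₂ j * rs j) * (-(c₂₁ j * rs j) + c₂₂ j * rc j))) : ℝ) : ℂ)) :
    ∀ q : ℕ, ∀ u : EuclideanSpace ℂ (Fin 3), (fun i => ((ℓ i : ℤ) : ℂ)) ⬝ᵥ WithLp.ofLp u = 0 →
        ‖u‖ ^ 2 ≤ wa q ⟨k₀ - 1, Nat.sub_lt W.pos one_pos⟩ ((q : ℝ) * W.period + W.start ⟨k₀ - 1, Nat.sub_lt W.pos one_pos⟩ + (W.phase ⟨k₀ - 1, Nat.sub_lt W.pos one_pos⟩).τ) * ‖inner ℂ (WithLp.toLp 2 (Complex.ofReal ∘ ζr ⟨k₀ - 1, Nat.sub_lt W.pos one_pos⟩) : EuclideanSpace ℂ (Fin 3)) u‖ ^ 2 +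
          wb q ⟨k₀ - 1, Nat.sub_lt W.pos one_pos⟩ ((q : ℝ) * W.period + W.start ⟨k₀ - 1, Nat.sub_lt W.pos one_pos⟩ + (W.phase ⟨k₀ - 1, Nat.sub_lt W.pos one_pos⟩).τ) * ‖inner ℂ (WithLp.toLp 2 (Complex.ofReal ∘ pf ⟨k₀ - 1, Nat.sub_lt W.pos one_pos⟩ 0) : EuclideanSpace ℂ (Fin 3)) u‖ ^ 2 +
          2 * (wc q ⟨k₀ - 1, Nat.sub_lt W.pos one_pos⟩ ((q : ℝ) * W.period + W.start ⟨k₀ - 1, Nat.sub_lt W.pos one_pos⟩ + (W.phase ⟨k₀ - 1, Nat.sub_lt W.pos one_pos⟩).τ) * conj (inner ℂ (WithLp.toLp 2 (Complex.ofReal ∘ ζr ⟨k₀ - 1, Nat.sub_lt W.pos one_pos⟩) : EuclideanSpace ℂ (Fin 3)) u) * inner ℂ (WithLp.toLp 2 (Complex.ofReal ∘ pf ⟨k₀ - 1, Nat.sub_lt W.pos one_pos⟩ 0) : EuclideanSpace ℂ (Fin 3)) u).re := by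
  intro q u hu
  have h00 := hζ1 ⟨0, W.pos⟩
  have h0k := hζ0 ⟨0, W.pos⟩
  have hx : ((Real.sqrt ((fun i => ((ℓ i : ℤ) : ℝ)) ⬝ᵥ (fun i => ((ℓ i : ℤ) : ℝ))))⁻¹ • (fun i => ((ℓ i : ℤ) : ℝ))) ⨯₃ ζr ⟨0, W.pos⟩ = (Real.sqrt ((fun i => ((ℓ i : ℤ) : ℝ)) ⬝ᵥ (fun i => ((ℓ i : ℤ) : ℝ))))⁻¹ • ((fun i => ((ℓ i : ℤ) : ℝ)) ⨯₃ ζr ⟨0, W.pos⟩) := by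
    rw [LinearMap.map_smul, LinearMap.smul_apply]
  obtain ⟨ea, eb, -⟩ := frame_bridge_inner hℓ h00 h0k (hζ1 ⟨k₀ - 1, Nat.sub_lt W.pos one_pos⟩)
    (hζ0 ⟨k₀ - 1, Nat.sub_lt W.pos one_pos⟩) u
  rw [← hrc ⟨k₀ - 1, Nat.sub_lt W.pos one_pos⟩, ← hrs ⟨k₀ - 1, Nat.sub_lt W.pos one_pos⟩] at ea eb
  have h := comoving_end W Λ d0 σo σi g₁ rc rs lam c₁₁ c₁₂ c₂₁ c₂₂ hCsucc hEND q
    (inner ℂ (WithLp.toLp 2 (Complex.ofReal ∘ ζr ⟨0, W.pos⟩) : EuclideanSpace ℂ (Fin 3)) u)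
    (inner ℂ (WithLp.toLp 2 (Complex.ofReal ∘ (((Real.sqrt ((fun i => ((ℓ i : ℤ) : ℝ)) ⬝ᵥ (fun i => ((ℓ i : ℤ) : ℝ))))⁻¹ • (fun i => ((ℓ i : ℤ) : ℝ))) ⨯₃ ζr ⟨0, W.pos⟩)) : EuclideanSpace ℂ (Fin 3)) u)
  rw [← ea, ← eb, ← hp0 ⟨k₀ - 1, Nat.sub_lt W.pos one_pos⟩] at h
  rw [norm_sq_eq_blocks_of_transversal hℓ h00 h0k u hu, ← hx]
  simp only [hwa, hwb, hwc]
  exact h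

end Summit.AnomalousDissipation.AnomalousDissipation.Theorems.SolenoidalFractalHomogenisation.RealisedQuasiStaticCellLaw

end
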